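import Mathlib
import HarnessLib
import Summits.HubbardSuperconductivity.HubbardSuperconductivity.Theorems.KLProgrammeKLRegimeSplitTwoLegSizesMSLamShape
import Summits.HubbardSuperconductivity.HubbardSuperconductivity.Theorems.KLProgrammeKLRegimeSplitTwoLegSizesMSFitPiecesAll

/-!
# Route `KLProgramme`, crux K3 — ENGINE child (`KLRegimeEngineV16`, `stub_twoLeg_step`, clause (E3a-MS-Q)): the (E3a-MS-TQ) slot conjunct
# `TwoLegSizesMSTQ … (n+1)` FROM THE ENGINE'S PROFILES AND ONE PACKAGE INEQUALITY PER ORDER — no fit hypothesis left (k3c3-p1 g4)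

Seat hubbard-kl-k3c3-p1 (g4); closes the (E3a-MS) supplier chain of MS-A34 / MS-A0 / MS-A34-ter.  Composition, at Jackson degree `d = 4^{n+1}`, of

* the hypothesis-free Λ-supplier `twoLegSizesMSTQ_succ_of_pieces_mixed` (`…TwoLegSizesMSLowMixed`: low-part totals `Λ_j := msLam R U d (n+1) j`),
* the Λ-shapes `msLam_three_le` / `msLam_four_le` (`…TwoLegSizesMSLamShape`: `lam3 = 512π⁸`, `lam4 = 2048π⁸`),
* the fit arithmetic `msPieceSlotL_le` / `msPieceBaseL_le` (`…TwoLegSizesMSFitPiecesAll`, k3c3-p3 g4),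
* the chain regime `chain_regime_of_pieces_graded` (`…TwoLegSizesMSWithPieces`) and `msA_nonneg`.

**`twoLegSizesMSTQ_succ_of_profiles`** — binders: the KL regime (`c ≤ klCurveC3 R/16`, `0 < U ≤ min (klCurveU0 R/16) 1`, `klBetaMin ≤ β ≤ e^{c/U²}`,
`μ ∈ klWindowC`), the frame as a sum of pieces `Kp m` of sizes `pieceSize R U m j` (`j ≤ 4`), the engine's representation of the local-part
increment at scale `n+1` by symbols `S k` with size profile `σ k l` and one-piece responses `ε m l` (engine exports, as in `…MSLowMixed`), the
cutoff-derivative bound `X`, the PROFILE SHAPES written out (`σ k l ≤ μ_l·U²·4^{(l−2)n}…`, `ε m l ≤ ν_l·U²4^{−(n+1)}·pieceSize-like`, exactly the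
`hs*` / `he*` of `msPieceSlotL_le` / `msPieceBaseL_le`), and the THREE package inequalities
`msReqSlot X mu nu R (512π⁸) (2048π⁸) j ≤ Q.CE·G.S 1·R.Gfr j`, `msReqBase0 X mu j ≤ G.S j/2`, `U·msReqBase1 X mu R (512π⁸) (2048π⁸) j ≤ G.S j/2`
(`j ≤ 4`) — conclusion `TwoLegSizesMSTQ L M G Q R β U μ K (n+1)`.

Proofs only; nothing about the model.
-/

noncomputable section

namespace Summit.HubbardSuperconductivity.HubbardSuperconductivity.Theorems.KLRegimeSplit

set_option linter.dupNamespace false -- summit = problem name (single-conjunct summit), D-0017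

open Real Finset Literature.MathematicalPhysics.QuantumLattice Literature.MathematicalPhysics.QuantumLattice.FermiRG
open Summit.HubbardSuperconductivity.HubbardSuperconductivity.Theorems.KLProgrammeLegKernels
open Summit.HubbardSuperconductivity.HubbardSuperconductivity.Theorems.DispersionFlow
open Summit.HubbardSuperconductivity.HubbardSuperconductivity.Theorems.PerturbedFermiCurve

/-- The chain's `C²` budget `msA R c U = 16·(2Gfr₀|U| + 2Gfr₁U² + Gfr₂·c/log 4)` is nonnegative for `0 ≤ c`. -/
theorem msA_nonneg {R : RenConsts} (hR : ∀ j, 0 ≤ R.Gfr j) {c : ℝ} (hc : 0 ≤ c) (U : ℝ) : 0 ≤ msA R c U := by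
  have h0 := hR 0
  have h1 := hR 1
  have h2 := hR 2
  have hlog : 0 < Real.log 4 := Real.log_pos (by norm_num)
  unfold msA
  positivity

section MS

variable {L M : ℕ} [NeZero L] [NeZero M] {G : GeoConsts} {Q : EngConsts} {R : RenConsts} {β U μ : ℝ}

/-- **(E3a-MS-TQ) AT THE SCALES `n + 1 ≤ n_β` FROM THE ENGINE PROFILES** — `TwoLegSizesMSTQ L M G Q R β U μ K (n+1)` with NO fit and NO low-part
hypothesis: the Λ-supplier `twoLegSizesMSTQ_succ_of_pieces_mixed` at `d = 4^{n+1}`, its fits discharged by `msPieceBaseL_le` / `msPieceSlotL_le`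
(k3c3-p3) at `lam3 = 512π⁸`, `lam4 = 2048π⁸` (`msLam_three_le` / `msLam_four_le`). -/
theorem twoLegSizesMSTQ_succ_of_profiles (hR : ∀ j, 0 ≤ R.Gfr j) {c : ℝ} (hc : 0 < c) (hcle : c ≤ klCurveC3 R / 16)
    (hU : 0 < U) (hUle : U ≤ klCurveU0 R / 16) (hU1 : U ≤ 1) (hβmin : klBetaMin ≤ β) (hβc : β ≤ Real.exp (c / U ^ 2))
    (hμ : μ ∈ klWindowC)
    {K : TrigPolyC4v} {Kp : ℕ → TrigPolyC4v} (hK : ∀ p : Fin 2 → ℝ, K.eval p = ∑ m ∈ range (nScales β + 1), (Kp m).eval p)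
    (ha : ∀ m ≤ nScales β, ∀ j ≤ 4, ∀ q : Momentum, ‖iteratedFDeriv ℝ j (evalM (Kp m)) q‖ ≤ pieceSize R U m j)
    {n : ℕ} (hn : n + 1 ≤ nScales β)
    (hc₁ : Continuous (klLocalPart L M β U μ K (n + 1))) (hc₀ : Continuous (klLocalPart L M β U μ K n))
    {S : ℕ → TrigPolyC4v}
    (hS : ∀ θ, klLocalPart L M β U μ K (n + 1) θ - klLocalPart L M β U μ K n θ =
      (S (nScales β - (n + 1))).eval (klFermiPoint μ K θ))
    {σ : ℕ → ℕ → ℝ} (hσnn : ∀ k l, 0 ≤ σ k l)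
    (hσ0 : ∀ k ≤ nScales β - (n + 1), ∀ q : Momentum, |evalM (S k) q| ≤ σ k 0)
    (hσ : ∀ k ≤ nScales β - (n + 1), ∀ l, 1 ≤ l → l ≤ 5 → ∀ q : Momentum, ‖iteratedFDeriv ℝ l (evalM (S k)) q‖ ≤ σ k l)
    {ε : ℕ → ℕ → ℝ} (hεnn : ∀ m l, 0 ≤ ε m l)
    (hε0 : ∀ m ∈ Ioc (n + 1) (nScales β), ∀ q : Momentum, |evalM (fsub (S (m - (n + 1))) (S (m - (n + 1) - 1))) q| ≤ ε m 0)
    (hε : ∀ m ∈ Ioc (n + 1) (nScales β), ∀ l, 1 ≤ l → l ≤ 4 → ∀ q : Momentum,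
      ‖iteratedFDeriv ℝ l (evalM (fsub (S (m - (n + 1))) (S (m - (n + 1) - 1)))) q‖ ≤ ε m l)
    {X : ℝ} (hX : ∀ l ≤ 4, ∀ x : ℝ, ‖iteratedFDeriv ℝ l salmhoferCutoff x‖ ≤ X)
    (hCE : 0 ≤ Q.CE) (hS' : ∀ j, 0 ≤ Q.S' j)
    {mu nu : ℕ → ℝ} (hmu : ∀ i, 0 ≤ mu i) (hnu : ∀ i, 0 ≤ nu i)
    (hs0 : σ 0 0 ≤ 16 * mu 0 * U ^ 2 / ((4 : ℝ) ^ (n + 1)) ^ 2)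
    (hs1 : ∀ k ≤ nScales β - (n + 1), σ k 1 ≤ 4 * mu 1 * U ^ 2 / ((4 : ℝ) ^ (n + 1)))
    (hs2 : ∀ k ≤ nScales β - (n + 1), σ k 2 ≤ mu 2 * U ^ 2)
    (hs3 : ∀ k ≤ nScales β - (n + 1), σ k 3 ≤ mu 3 * U ^ 2 * ((4 : ℝ) ^ (n + 1)) / 4)
    (hs4 : ∀ k ≤ nScales β - (n + 1), σ k 4 ≤ mu 4 * U ^ 2 * ((4 : ℝ) ^ (n + 1)) ^ 2 / 16)
    (hs5 : ∀ k ≤ nScales β - (n + 1), σ k 5 ≤ mu 5 * U ^ 2 * ((4 : ℝ) ^ (n + 1)) ^ 3 / 64)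
    (he0 : ∀ m ∈ Ioc (n + 1) (nScales β), ε m 0 ≤ nu 0 * U ^ 2 / ((4 : ℝ) ^ (n + 1)) * (R.Gfr 0 * U / ((4 : ℝ) ^ m) ^ 2))
    (he1 : ∀ m ∈ Ioc (n + 1) (nScales β), ε m 1 ≤ nu 1 * U ^ 2 / ((4 : ℝ) ^ (n + 1)) * (R.Gfr 1 * U ^ 2 / ((4 : ℝ) ^ m)))
    (he2 : ∀ m ∈ Ioc (n + 1) (nScales β), ε m 2 ≤ nu 2 * U ^ 2 / ((4 : ℝ) ^ (n + 1)) * (R.Gfr 2 * U ^ 2))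
    (he3 : ∀ m ∈ Ioc (n + 1) (nScales β), ε m 3 ≤ nu 3 * U ^ 2 / ((4 : ℝ) ^ (n + 1)) * (R.Gfr 3 * U ^ 2 * ((4 : ℝ) ^ m)))
    (he4 : ∀ m ∈ Ioc (n + 1) (nScales β), ε m 4 ≤ nu 4 * U ^ 2 / ((4 : ℝ) ^ (n + 1)) * (R.Gfr 4 * U ^ 2 * ((4 : ℝ) ^ m) ^ 2))
    (hfit : ∀ j ≤ 4, msReqSlot X mu nu R (512 * π ^ 8) (2048 * π ^ 8) j ≤ Q.CE * G.S 1 * R.Gfr j)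
    (hfit0 : ∀ j ≤ 4, msReqBase0 X mu j ≤ G.S j / 2)
    (hfit1 : ∀ j ≤ 4, U * msReqBase1 X mu R (512 * π ^ 8) (2048 * π ^ 8) j ≤ G.S j / 2) :
    TwoLegSizesMSTQ L M G Q R β U μ K (n + 1) := by
  -- the chain regime at scale `n + 1`
  have hreg := chain_regime_of_pieces_graded hR hc hcle hU hUle hβmin hβc hμ ha (4 ^ (n + 1)) hn
  have hA0 : 0 ≤ msA R c U := msA_nonneg hR hc.le U
  have hA20 : msA R c U ≤ 1 / 20 := hreg.2.1
  have hd : klCurveD ≤ msDt - 2 * msA R c U := hreg.2.2.1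
  have hX0 : 0 ≤ X := le_trans (norm_nonneg _) (hX 0 (by norm_num) 0)
  have hn₀ : 1 ≤ n + 1 := Nat.succ_pos n
  have hlam3 : (0 : ℝ) ≤ 512 * π ^ 8 := by positivity
  have hlam4 : (0 : ℝ) ≤ 2048 * π ^ 8 := by positivity
  -- the Λ-shapes at `d = 4^{n+1}`
  have hΛ₃0 := msLam_nonneg hR U (4 ^ (n + 1)) (n + 1) 3
  have hΛ₄0 := msLam_nonneg hR U (4 ^ (n + 1)) (n + 1) 4
  have hΛ₃ := msLam_three_le hR U (n + 1)
  have hΛ₄ := msLam_four_le hR U (n + 1)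
  refine twoLegSizesMSTQ_succ_of_pieces_mixed hR hc hcle hU hUle hβmin hβc hμ hK ha hn (4 ^ (n + 1)) hc₁ hc₀ hS hσnn hσ0 hσ
    hεnn hε0 hε hX ?_ ?_
  · -- base fits
    exact msPieceBaseL_le (hR := hR) (hU := hU) (hU1 := hU1) (hn₀ := hn₀) (hX := hX0) (hlam3 := hlam3) (hlam4 := hlam4)
      (hS' := hS') (hμ := hmu) (hΛ₃0 := hΛ₃0) (hΛ₃ := hΛ₃) (hΛ₄0 := hΛ₄0) (hΛ₄ := hΛ₄) (hσ0 := hσnn)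
      (hs0 := hs0) (hs1 := hs1 0 (Nat.zero_le _)) (hs2 := hs2 0 (Nat.zero_le _)) (hs3 := hs3 0 (Nat.zero_le _))
      (hs4 := hs4 0 (Nat.zero_le _)) (hfit0 := hfit0) (hfit1 := hfit1)
  · -- slot fits
    intro m hm
    have hm' : n + 1 + 1 ≤ m := (mem_Ioc.mp hm).1
    have hk : m - (n + 1) - 1 ≤ nScales β - (n + 1) := by have := (mem_Ioc.mp hm).2; omega
    exact msPieceSlotL_le (hR := hR) (hU := hU) (hU1 := hU1) (hn₀ := hn₀) (hm := hm') (hX := hX0) (hlam3 := hlam3) (hlam4 := hlam4)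
      (hCE := hCE) (hS1' := hS' 1) (hμ := hmu) (hν := hnu) (hA0 := hA0) (hA20 := hA20) (hd := hd)
      (hΛ₃0 := hΛ₃0) (hΛ₃ := hΛ₃) (hΛ₄0 := hΛ₄0) (hΛ₄ := hΛ₄) (hσ0 := hσnn)
      (hs1 := hs1 _ hk) (hs2 := hs2 _ hk) (hs3 := hs3 _ hk) (hs4 := hs4 _ hk) (hs5 := hs5 _ hk) (hε0 := hεnn)
      (he0 := he0 m hm) (he1 := he1 m hm) (he2 := he2 m hm) (he3 := he3 m hm) (he4 := he4 m hm) (hfit := hfit)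

end MS

end Summit.HubbardSuperconductivity.HubbardSuperconductivity.Theorems.KLRegimeSplit

end
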